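import Literature.NumberTheory.Transcendental.AnalyticSubgroupSemistable
import Literature.NumberTheory.Transcendental.UnivExtAlgPoints
import Mathlib.LinearAlgebra.FreeModule.PID
import HarnessLib

/-!
# The Semistability Theorem for the quotients of `𝔾ₐ × 𝔾ₘ^ι × (E♮)^κ` in explicit coordinates

Topic: `Literature/NumberTheory/Transcendental`. Decomposition layer for the named fact
`Literature.NumberTheory.Transcendental.HuberWustholzOnePeriods` (item `provefact-Literature.Periods.HuberWustholzOnePeriods`),
one level below `AnalyticSubgroupSemistable.lean`: there the seven-period statement (and the
hyperplane form of the analytic subgroup theorem for `G = 𝔾ₐ × 𝔾ₘ^ι × (E♮)^κ`) was reduced to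
`semistabilityTheorem_GaGmE`, Baker–Wüstholz's Semistability Theorem (*Logarithmic Forms and
Diophantine Geometry*, Thm. 6.15) **for the quotients `G/H`** of `G` by its connected algebraic
subgroups. A proof of that fact by Baker's method must work on the group `G/H` itself, so this
file makes the quotients explicit:

* it introduces the **explicit family `M_κ = 𝔾ₘ^β × P_κ`** (`GaGmE.Std.*`), where `P_κ` is the
  push-out of the universal vectorial extension `0 → 𝔾ₐ^γ → (E♮)^γ → E^γ → 0` along a
  `ℚ̄`-linear map `κ : ℚ̄^γ → ℚ̄^δ` (an extension of `E^γ` by `𝔾ₐ^δ`; `G` itself is the case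
  `κ = (0 ; id)`), with its Lie coordinates `(y'; z'; s)`, kernel
  `ker exp = (2πiℤ)^β × {(z', κ η(z')) : z' ∈ Λ^γ}`, algebraic points and connected algebraic
  subgroups (`Std.SubgroupData`, same classification as for `G`);
* it vendors ONE named fact, `semistabilityTheorem_std`: Thm. 6.15 of Baker–Wüstholz for the
  group varieties `M_κ` themselves (no quotients: `B ⊊ M_κ` semistable ⟹ `B(ℚ̄) = 0`);
* it PROVES `semistabilityTheorem_GaGmE_of_std : semistabilityTheorem_std → semistabilityTheorem_GaGmE`
  by constructing, for every connected algebraic `H = H_{(A₀,C₀,Ξ₀)} ⊆ G`, explicit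
  coordinates `Φ : Lie G → Lie M_κ` of `Lie(G/H)` (`GaGmE.QuotData`): unimodular integer bases
  `q⁽ʲ⁾` of `A₀ ∩ ℤ^ι` and `c⁽ᵇ⁾` of `C₀ ∩ ℤ^κ` (Smith normal form of these saturated lattices,
  `GaGmE.exists_unimodular_basis`), a `ℚ̄`-basis `ξ⁽ᵉ⁾` of `Ξ₀`, and the matrix `κ` with
  `ξ⁽ᵉ⁾_t = ∑_b κ_{eb} c⁽ᵇ⁾` (the compatibility `V ⊇ 0 ⊕ N`); then `y'_j = q⁽ʲ⁾ · y`,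
  `z'_b = c⁽ᵇ⁾ · z`, `s_e = ξ⁽ᵉ⁾(x, t)`, `ker Φ = Lie H`, `Φ` is onto, and
  - `Φ` maps `ℚ̄`-rational subspaces to `ℚ̄`-rational ones and `Φ⁻¹(Φ 𝔟) = 𝔟` for `𝔟 ⊇ Lie H`;
  - connected algebraic subgroups `K' ⊆ M_κ` pull back to connected algebraic `K ⊇ H` of `G`
    (`QuotData.pull`, `comap_tangent`) with `dim Φ⁻¹(X) = dim X + dim Lie H`, so semistability
    of `𝔟/Lie H` in `G/H` is semistability of `Φ(𝔟)` in `M_κ`;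
  - algebraic points of `G` map to algebraic points of `M_κ` (`Φ_mem_Alg`: characters of
    algebraic points of `𝔾ₘ^ι`, integer combinations of `ℚ̄`-points of `E♮`
    (`UnivExtAlgPoints.lean`), and `s_e - ∑_b κ_{eb} t'_b = ξ⁽ᵉ⁾₀ x`);
  - `ker(exp_{M_κ})` lifts to `ker(exp_G) + Lie H` (`exists_ker_of_Φ_mem_ker`) — this is where
    unimodularity is needed (`p ↦ (q⁽ʲ⁾ · p)ⱼ` maps `ℤ^ι` onto `ℤⁿ`).
  In other words `(G/H, exp, (G/H)(ℚ̄), its algebraic subgroups) ≅ (M_κ, …)` through `Φ`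
  (Baker–Wüstholz 2007, p. 115, the passage `G → G^* = G/H`), proved at the level of the
  presentations of `SemistableReduction.lean`.

Hence `HuberWustholzOnePeriods_of_std`, `analyticSubgroupTheorem_GaGmE_of_std`: the seven-period
statement now rests on the Semistability Theorem for the explicit groups `M_κ`, i.e. on the
Baker–Wüstholz analytic argument (op. cit. §6.8, pp. 116–119, with the multiplicity estimate
Thm. 6.14) for ONE explicit family of commutative group varieties with explicit exponential
maps `(e^{y'_j}; ℘(z'_b), ℘'(z'_b); s_e - ∑_b κ_{eb} ζ(z'_b))`.

## Faithfulness of the named fact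

`M_κ` is a connected commutative algebraic group over the number field generated by `g₂, g₃` and
the entries of `κ`; `Lie M_κ,ℂ = ℂ^β × (ℂ^γ × ℂ^γ × ℂ^δ)/{(0, v, -κv)} = ℂ^β × ℂ^γ × ℂ^δ` with
`s = s'' + κ t`, so `exp_{M_κ}(y', z', s) = 0` iff `y' ∈ (2πiℤ)^β`, `z' ∈ Λ^γ` and
`s = κ η(z')` (`GaGmE.Std.ker`), and `exp_{M_κ}(w)` is algebraic iff some representative
`(z', t', s'')` has `(z'_b, t'_b)` algebraic on `E♮` and `s'' = s - κ t'` algebraic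
(`GaGmE.Std.Alg`; `M_κ(ℚ̄) = ((E♮)^γ(ℚ̄) × ℚ̄^δ)/ℚ̄^γ`). The connected algebraic subgroups of
`M_κ` (`E` without CM) are classified exactly as those of `G` in `AnalyticSubgroupSemistable.lean`
(torus splits off; abelian part `B_N`, `N = C^⊥ ⊆ ℚ^γ`; vector part cut out by additive
characters `ξ` of `𝔾ₐ^δ`, where `Hom(P_κ ×_{E^γ} B_N, 𝔾ₐ) = {ξ : ξ ∘ κ ∈ N^⊥ ⊗ ℚ̄ = span_ℚ̄ C}`
because the pull-back of `P_κ` to `B_N` is the push-out of `B_N^♮` along `κ|_N` and `B_N^♮` is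
anti-affine, Brion 2009, Prop. 3.3; Huber–Wüstholz 2022, Prop. 4.18–4.20), which is
`GaGmE.Std.SubgroupData`; `Std.Semistable` is the printed semistability (op. cit. §6.7) of `𝔟` in
`M_κ` with respect to all proper quotients `M_κ/K`. The fact is then Thm. 6.15 verbatim for
`(M_κ, B = exp(𝔟_ℂ))`, restricted to non-CM `E` and to points of `B` of the form `exp(w)`,
`w ∈ 𝔟_ℂ` — nothing stronger than printed.

## References

* A. Baker, G. Wüstholz, *Logarithmic Forms and Diophantine Geometry*, CUP 2007: Thm. 6.15,
  §6.7, §6.8 (p. 115: reduction to a quotient; pp. 116–119: proof of Thm. 6.15).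
* A. Huber, G. Wüstholz, *Transcendence and Linear Relations of 1-Periods*, CUP 2022:
  Prop. 4.18, Def. 4.19, Prop. 4.20, Thm. 6.2, Thm. 15.3(1).
* M. Brion, *Anti-affine algebraic groups*, J. Algebra 321 (2009), Prop. 3.3.
-/

noncomputable section

open Complex Module Submodule

namespace Literature.NumberTheory.Transcendental

namespace GaGmE

/-! ### Base change of linear independence -/

/-- `K`-linearly independent vectors of `K^σ` are `L`-linearly independent in `L^σ` (expand a
relation in a `K`-basis of `L`). [folklore] -/
theorem linearIndependent_ofK {K L : Type*} [Field K] [Field L] [Algebra K L] {σ α : Type*}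
    {v : α → σ → K} (hv : LinearIndependent K v) :
    LinearIndependent L fun a => LiePresentation.ofK K (L := L) (v a) := by
  classical
  rw [linearIndependent_iff'] at hv ⊢
  intro s c hc a ha
  let b := Basis.ofVectorSpace K L
  -- every coordinate of `c` in the basis `b` gives a `K`-relation
  have key : ∀ j, ∑ a' ∈ s, (b.repr (c a') j) • v a' = 0 := by
    intro j
    funext i
    have h0 := congr_fun hc i
    simp only [Finset.sum_apply, Pi.smul_apply, LiePresentation.ofK_apply, smul_eq_mul,
      Pi.zero_apply] at h0
    have h1 := congrArg (fun x : L => b.repr x j) h0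
    simp only [map_sum, map_zero, Finsupp.coe_zero, Pi.zero_apply, Finsupp.coe_finsetSum,
      Finset.sum_apply] at h1
    simp only [Finset.sum_apply, Pi.smul_apply, smul_eq_mul, Pi.zero_apply]
    rw [← h1]
    refine Finset.sum_congr rfl fun a' _ => ?_
    rw [mul_comm (c a'), ← Algebra.smul_def, map_smul, Finsupp.smul_apply, smul_eq_mul, mul_comm]
  have : ∀ j, b.repr (c a) j = 0 := fun j => hv s (fun a' => b.repr (c a') j) (key j) a ha
  exact b.repr.map_eq_zero_iff.mp (Finsupp.ext this)

/-! ### Saturated sublattices of `ℤ^ι`: unimodular bases -/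

/-- The integer points of a `ℚ`-subspace of `ℚ^ι`: a saturated sublattice of `ℤ^ι`. [folklore] -/
def intPoints {ι : Type*} (A : Submodule ℚ (ι → ℚ)) : Submodule ℤ (ι → ℤ) where
  carrier := {p | (fun i => (p i : ℚ)) ∈ A}
  zero_mem' := by
    change (fun i => (((0 : ι → ℤ) i : ℤ) : ℚ)) ∈ A
    simp only [Pi.zero_apply, Int.cast_zero]
    exact A.zero_mem
  add_mem' := by
    intro p q hp hq
    have := A.add_mem hp hq
    simpa [Pi.add_def] using this
  smul_mem' := by
    intro c p hp
    have := A.smul_mem (c : ℚ) hp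
    simpa [Pi.smul_def, zsmul_eq_mul] using this

/-- Membership in `intPoints`. [folklore] -/
theorem mem_intPoints {ι : Type*} {A : Submodule ℚ (ι → ℚ)} {p : ι → ℤ} :
    p ∈ intPoints A ↔ (fun i => (p i : ℚ)) ∈ A := Iff.rfl

/-- **Unimodular bases of saturated lattices.** A `ℚ`-subspace `A ⊆ ℚ^ι` has a finite family of
integer vectors `q₁, …, qₙ ∈ A` spanning `A` over `ℚ` such that `p ↦ (qⱼ · p)ⱼ` maps `ℤ^ι`
ONTO `ℤⁿ` (Smith normal form of the saturated lattice `A ∩ ℤ^ι`: its invariant factors are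
units, so a basis of it is part of a basis of `ℤ^ι`). [folklore] -/
theorem exists_unimodular_basis {ι : Type} [Fintype ι] (A : Submodule ℚ (ι → ℚ)) :
    ∃ (n : ℕ) (q : Fin n → ι → ℤ), (∀ j, (fun i => (q j i : ℚ)) ∈ A) ∧
      (∀ v ∈ A, v ∈ Submodule.span ℚ (Set.range fun j i => (q j i : ℚ))) ∧
      ∀ t : Fin n → ℤ, ∃ p : ι → ℤ, ∀ j, ∑ i, q j i * p i = t j := by
  classical
  obtain ⟨n, snf⟩ := (intPoints A).smithNormalForm (Pi.basisFun ℤ ι)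
  obtain ⟨bM, bN, f, a, hsnf⟩ := snf
  -- the invariant factors are units, by saturation
  have ha : ∀ j, IsUnit (a j) := by
    intro j
    have hne : a j ≠ 0 := by
      intro h0
      have : (bN j : ι → ℤ) = 0 := by rw [hsnf j, h0, zero_smul]
      exact bN.ne_zero j (Subtype.ext this)
    -- `bM (f j) ∈ intPoints A` since `a j • bM (f j) ∈ A` and `A` is a `ℚ`-subspace
    have hmem : bM (f j) ∈ intPoints A := by
      have h1 : (bN j : ι → ℤ) ∈ intPoints A := (bN j).2
      rw [hsnf j, mem_intPoints] at h1
      rw [mem_intPoints]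
      have : (fun i => ((bM (f j)) i : ℚ)) = (a j : ℚ)⁻¹ • fun i => (((a j • bM (f j)) i : ℤ) : ℚ) := by
        funext i
        simp [Pi.smul_apply]
        field_simp [show (a j : ℚ) ≠ 0 by exact_mod_cast hne]
      rw [this]
      exact A.smul_mem _ h1
    -- write `bM (f j)` in the basis `bN`: the coefficient at `f j` gives `1 = c j * a j`
    obtain ⟨c, hc⟩ := (Basis.mem_submodule_iff' bN).mp hmem
    have hcoord := congrArg (fun x : ι → ℤ => bM.repr x (f j)) hc
    simp only [Basis.repr_self, Finsupp.single_eq_same, map_sum, map_smul, hsnf,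
      Finsupp.coe_finsetSum, Finset.sum_apply, Finsupp.smul_apply, smul_eq_mul,
      Finsupp.single_apply, EmbeddingLike.apply_eq_iff_eq] at hcoord
    rw [Finset.sum_eq_single j (fun j' _ hj' => by simp [hj']) (fun h => absurd (Finset.mem_univ j) h)]
      at hcoord
    simp only [if_true] at hcoord
    exact IsUnit.of_mul_eq_one_right (c j) (by linarith [hcoord])
  -- the vectors
  refine ⟨n, fun j => bM (f j), fun j => ?_, fun v hv => ?_, fun t => ?_⟩
  · -- membership (as above)
    have h1 : (bN j : ι → ℤ) ∈ intPoints A := (bN j).2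
    rw [hsnf j, mem_intPoints] at h1
    obtain ⟨u, hu⟩ := ha j
    have : (fun i => ((bM (f j)) i : ℚ)) = (a j : ℚ)⁻¹ • fun i => (((a j • bM (f j)) i : ℤ) : ℚ) := by
      funext i
      have hne : (a j : ℚ) ≠ 0 := by exact_mod_cast (ha j).ne_zero
      simp [Pi.smul_apply]
      field_simp
    rw [this]
    exact A.smul_mem _ h1
  · -- spanning: clear denominators, then use the `ℤ`-basis `bN` of `intPoints A`
    obtain ⟨d, hd, nv, hnv⟩ := exists_common_den v
    have hint : nv ∈ intPoints A := by
      rw [mem_intPoints]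
      have : (fun i => (nv i : ℚ)) = (d : ℚ) • v := by funext i; simp [hnv i]
      rw [this]; exact A.smul_mem _ hv
    obtain ⟨c, hc⟩ := (Basis.mem_submodule_iff' bN).mp hint
    have hv_eq : v = (d : ℚ)⁻¹ • fun i => (nv i : ℚ) := by
      funext i
      simp only [Pi.smul_apply, smul_eq_mul, ← hnv i]
      field_simp [show (d : ℚ) ≠ 0 by exact_mod_cast hd.ne']
    rw [hv_eq]
    refine Submodule.smul_mem _ _ ?_
    have : (fun i => (nv i : ℚ)) = ∑ j', ((c j' * a j' : ℤ) : ℚ) • fun i => ((bM (f j')) i : ℚ) := by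
      funext i
      rw [hc]
      simp only [Finset.sum_apply, Pi.smul_apply, hsnf, zsmul_eq_mul, smul_eq_mul, Pi.mul_apply]
      push_cast
      exact Finset.sum_congr rfl fun j' _ => by simp [mul_assoc]
    rw [this]
    exact Submodule.sum_mem _ fun j' _ => Submodule.smul_mem _ _ (Submodule.subset_span ⟨j', rfl⟩)
  · -- unimodularity: realise the functional `bM k ↦ T k` as a dot product
    let T : ι → ℤ := fun k => ∑ j, if f j = k then t j else 0
    have hT : ∀ j, T (f j) = t j := by
      intro j
      simp only [T]
      rw [Finset.sum_eq_single j (fun j' _ hj' => by simp [hj']) (fun h => absurd (Finset.mem_univ j) h)]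
      simp
    let φ : Module.Dual ℤ (ι → ℤ) := ∑ k, T k • bM.dualBasis k
    have hφ : ∀ k, φ (bM k) = T k := by
      intro k
      simp only [φ, LinearMap.coe_sum, Finset.sum_apply, LinearMap.smul_apply, smul_eq_mul,
        Basis.dualBasis_apply_self]
      simp
    let p : ι → ℤ := fun i => φ (Pi.single i 1)
    have hp : ∀ u : ι → ℤ, ∑ i, u i * p i = φ u := by
      intro u
      conv_rhs => rw [pi_eq_sum_univ u]
      simp only [map_sum, map_smul, smul_eq_mul, p]
      refine Finset.sum_congr rfl fun i _ => ?_
      congr 2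
      funext j
      simp [Pi.single_apply, eq_comm]
    refine ⟨p, fun j => ?_⟩
    rw [hp, hφ, hT]

/-! ### The explicit family `M_κ = 𝔾ₘ^β × P_κ` (standard quotient presentations) -/

namespace Std

variable {β γ δ : Type}

/-- Index of the `𝔾ₘ`-coordinate `y'_j`. [folklore] -/
def iy (j : β) : β ⊕ (γ ⊕ δ) := Sum.inl j
/-- Index of the `E`-coordinate `z'_b`. [folklore] -/
def iz (b : γ) : β ⊕ (γ ⊕ δ) := Sum.inr (Sum.inl b)
/-- Index of the vector-group coordinate `s_e`. [folklore] -/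
def is (e : δ) : β ⊕ (γ ⊕ δ) := Sum.inr (Sum.inr e)

/-- Block vectors. [folklore] -/
def coords {R : Type*} (y : β → R) (z : γ → R) (s : δ → R) : β ⊕ (γ ⊕ δ) → R :=
  Sum.elim y (Sum.elim z s)

/-- The `y'`-block. [folklore] -/
@[simp] theorem coords_iy {R : Type*} (y : β → R) (z : γ → R) (s : δ → R) (j : β) :
    coords y z s (iy j) = y j := rfl
/-- The `z'`-block. [folklore] -/
@[simp] theorem coords_iz {R : Type*} (y : β → R) (z : γ → R) (s : δ → R) (b : γ) :
    coords y z s (iz b) = z b := rfl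
/-- The `s`-block. [folklore] -/
@[simp] theorem coords_is {R : Type*} (y : β → R) (z : γ → R) (s : δ → R) (e : δ) :
    coords y z s (is e) = s e := rfl

variable [Fintype β] [Fintype γ] [Fintype δ]

/-- Splitting a sum over the three blocks. [folklore] -/
theorem sum_blocks {M : Type*} [AddCommMonoid M] (F : β ⊕ (γ ⊕ δ) → M) :
    ∑ x, F x = ∑ j, F (iy j) + ∑ b, F (iz b) + ∑ e, F (is e) := by
  simp only [Fintype.sum_sum_type, add_assoc]
  rfl

/-- `y'`-forms. [folklore] -/
def yForm (q : β → ℚ) : β ⊕ (γ ⊕ δ) → Kbar := coords (fun j => (q j : Kbar)) (fun _ => 0) (fun _ => 0)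
/-- `z'`-forms. [folklore] -/
def zForm (c : γ → ℚ) : β ⊕ (γ ⊕ δ) → Kbar := coords (fun _ => 0) (fun b => (c b : Kbar)) (fun _ => 0)
/-- `s`-forms. [folklore] -/
def sForm (ξ : δ → Kbar) : β ⊕ (γ ⊕ δ) → Kbar := coords (fun _ => 0) (fun _ => 0) ξ

/-- Evaluation of `y'`-forms. [folklore] -/
theorem pair_yForm (q : β → ℚ) (w : β ⊕ (γ ⊕ δ) → ℂ) :
    LiePresentation.pair Kbar (yForm (γ := γ) (δ := δ) q) w = ∑ j, (q j : ℂ) * w (iy j) := by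
  simp only [LiePresentation.pair]; rw [sum_blocks]; simp [yForm]
/-- Evaluation of `z'`-forms. [folklore] -/
theorem pair_zForm (c : γ → ℚ) (w : β ⊕ (γ ⊕ δ) → ℂ) :
    LiePresentation.pair Kbar (zForm (β := β) (δ := δ) c) w = ∑ b, (c b : ℂ) * w (iz b) := by
  simp only [LiePresentation.pair]; rw [sum_blocks]; simp [zForm]
/-- Evaluation of `s`-forms. [folklore] -/
theorem pair_sForm (ξ : δ → Kbar) (w : β ⊕ (γ ⊕ δ) → ℂ) :
    LiePresentation.pair Kbar (sForm (β := β) (γ := γ) ξ) w = ∑ e, (ξ e : ℂ) * w (is e) := by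
  simp only [LiePresentation.pair]; rw [sum_blocks]; simp [sForm]

/-- **Connected algebraic subgroups of `M_κ = 𝔾ₘ^β × P_κ`** (`P_κ` the push-out of the
universal extension of `E^γ` along `κ : ℚ̄^γ → ℚ̄^δ`, `E` non-CM), dual data as for `G`:
characters `A ≤ ℚ^β`, homomorphisms `C ≤ ℚ^γ`, additive characters `Ξ ≤ ℚ̄^δ` of the vector
part, with the compatibility `ξ ∘ κ ∈ span_ℚ̄ C` (= `N^⊥`, `N = C^⊥` the abelian part).
[folklore] -/
structure SubgroupData (β γ δ : Type) [Fintype β] [Fintype γ] [Fintype δ] (κM : δ → γ → Kbar)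
    where
  /-- Rational characters of `𝔾ₘ^β` killing `Lie H`. -/
  A : Submodule ℚ (β → ℚ)
  /-- Rational homomorphisms `E^γ → E` killing the abelian part. -/
  C : Submodule ℚ (γ → ℚ)
  /-- Additive characters of the vector part `𝔾ₐ^δ` killing the vector part of `H`. -/
  Ξ : Submodule Kbar (δ → Kbar)
  /-- Compatibility: `ξ ∘ κ ∈ span C` for `ξ ∈ Ξ`. -/
  compat : ∀ ξ ∈ Ξ, (fun b => ∑ e, ξ e * κM e b) ∈
    Submodule.span Kbar ((fun c : γ → ℚ => fun b => (c b : Kbar)) '' (C : Set (γ → ℚ)))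

namespace SubgroupData

variable {κM : δ → γ → Kbar}

/-- The forms cutting out `Lie H`. [folklore] -/
def forms (D : SubgroupData β γ δ κM) : Set (β ⊕ (γ ⊕ δ) → Kbar) :=
  (yForm '' (D.A : Set (β → ℚ))) ∪ (zForm '' (D.C : Set (γ → ℚ))) ∪ (sForm '' (D.Ξ : Set (δ → Kbar)))

/-- `Lie H_ℂ`. [folklore] -/
def tangent (D : SubgroupData β γ δ κM) : Submodule ℂ (β ⊕ (γ ⊕ δ) → ℂ) :=
  LiePresentation.solSpace Kbar D.forms

/-- Membership in `Lie H`. [folklore] -/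
theorem mem_tangent_iff (D : SubgroupData β γ δ κM) (w : β ⊕ (γ ⊕ δ) → ℂ) :
    w ∈ D.tangent ↔ (∀ q ∈ D.A, ∑ j, (q j : ℂ) * w (iy j) = 0) ∧
      (∀ c ∈ D.C, ∑ b, (c b : ℂ) * w (iz b) = 0) ∧ ∀ ξ ∈ D.Ξ, ∑ e, (ξ e : ℂ) * w (is e) = 0 := by
  simp only [tangent, LiePresentation.mem_solSpace, forms, Set.mem_union, Set.mem_image]
  constructor
  · intro h
    refine ⟨fun q hq => ?_, fun c hc => ?_, fun ξ hξ => ?_⟩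
    · rw [← pair_yForm]; exact h _ (Or.inl (Or.inl ⟨q, hq, rfl⟩))
    · rw [← pair_zForm]; exact h _ (Or.inl (Or.inr ⟨c, hc, rfl⟩))
    · rw [← pair_sForm]; exact h _ (Or.inr ⟨ξ, hξ, rfl⟩)
  · rintro ⟨hA, hC, hΞ⟩ φ ((⟨q, hq, rfl⟩ | ⟨c, hc, rfl⟩) | ⟨ξ, hξ, rfl⟩)
    · rw [pair_yForm]; exact hA q hq
    · rw [pair_zForm]; exact hC c hc
    · rw [pair_sForm]; exact hΞ ξ hξ

end SubgroupData

variable (L : PeriodPair) (κM : δ → γ → Kbar)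

/-- `ker(exp_{M_κ}) = (2πiℤ)^β × {(z', κ η(z')) : z' ∈ Λ^γ}`. [folklore] -/
def ker : Set (β ⊕ (γ ⊕ δ) → ℂ) :=
  {w | (∀ j, ∃ p : ℤ, w (iy j) = p * (2 * Real.pi * I)) ∧
    ∃ m n : γ → ℤ, (∀ b, w (iz b) = m b * L.ω₁ + n b * L.ω₂) ∧
      ∀ e, w (is e) = ∑ b, (κM e b : ℂ) * (m b * L.η₁ + n b * L.η₂)}

/-- `exp_{M_κ}⁻¹(M_κ(ℚ̄))`: `e^{y'_j} ∈ ℚ̄`, and some representative `(z', t', s'')` of `(z', s)`,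
`s = s'' + κ t'`, has `(z'_b, t'_b)` a `ℚ̄`-point of `E♮` and `s'' ∈ ℚ̄^δ`. [folklore] -/
def Alg : Set (β ⊕ (γ ⊕ δ) → ℂ) :=
  {w | (∀ j, IsAlgebraic ℚ (cexp (w (iy j)))) ∧
    ∃ t' : γ → ℂ, (∀ b, L.IsUnivExtAlgPoint (w (iz b)) (t' b)) ∧
      ∀ e, IsAlgebraic ℚ (w (is e) - ∑ b, (κM e b : ℂ) * t' b)}

/-- The Lie algebras of the connected algebraic subgroups of `M_κ`. [folklore] -/
def algLie : Set (Submodule ℂ (β ⊕ (γ ⊕ δ) → ℂ)) :=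
  Set.range fun D : SubgroupData β γ δ κM => D.tangent

/-- Semistability of `𝔟 ⊆ Lie M_κ` (in `M_κ` itself, i.e. `𝔥 = 0` in `LiePresentation.Semistable`):
`dim 𝔟 / dim M_κ ≤ (dim 𝔟 - dim(𝔟 ∩ 𝔨)) / (dim M_κ - dim 𝔨)` for all `𝔨 = Lie K`, `K ≠ M_κ`
connected algebraic (Baker–Wüstholz 2007, §6.7). [cite: BakerWustholz2007, §6.7 (index and semistability)] -/
def Semistable (𝔟 : Submodule ℂ (β ⊕ (γ ⊕ δ) → ℂ)) : Prop :=
  ∀ 𝔨 ∈ algLie κM, 𝔨 ≠ ⊤ →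
    finrank ℂ 𝔟 * (Fintype.card (β ⊕ (γ ⊕ δ)) - finrank ℂ 𝔨) ≤
      (finrank ℂ 𝔟 - finrank ℂ ↥(𝔟 ⊓ 𝔨)) * Fintype.card (β ⊕ (γ ⊕ δ))

end Std

end GaGmE

/-- NAMED FACT — **Baker–Wüstholz's Semistability Theorem for the explicit group varieties
`M_κ = 𝔾ₘ^β × P_κ`.** Here `Λ` has algebraic invariants and no complex multiplication,
`E : y² = 4x³ - g₂x - g₃` over `ℚ̄`, `κ = (κ_{eb}) ∈ ℚ̄^{δ × γ}`, and `P_κ` is the push-out of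
the universal vectorial extension `0 → 𝔾ₐ^γ → (E♮)^γ → E^γ → 0` along the linear map
`κ : 𝔾ₐ^γ → 𝔾ₐ^δ` — a commutative group variety over a number field, extension of `E^γ` by
`𝔾ₐ^δ`, with `Lie P_κ,ℂ = ℂ^γ × ℂ^δ` (coordinates `z'_b, s_e`),
`ker exp_{P_κ} = {(z', κ η(z')) : z' ∈ Λ^γ}` and algebraic points as in `GaGmE.Std.Alg`
(a point of `P_κ = ((E♮)^γ × 𝔾ₐ^δ)/𝔾ₐ^γ` is algebraic iff it has an algebraic representative).
Every quotient `G/H` of `G = 𝔾ₐ × 𝔾ₘ^ι × (E♮)^κ` by a connected algebraic subgroup is of this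
form (see `semistabilityTheorem_GaGmE_of_std`; `G` itself is `κ = (0 ; id)`), but the fact is
stated — as printed — for the group varieties `M_κ` directly; their connected algebraic subgroups are
the `H_{(A,C,Ξ)}` of `GaGmE.Std.SubgroupData` (same classification as in
`AnalyticSubgroupSemistable.lean`, with the push-out `P_κ` in place of `𝔾ₐ × (E♮)^κ`:
`Hom(P_κ ×_{E^γ} B_N, 𝔾ₐ) = {ξ ∈ (ℚ̄^δ)^∨ : ξ ∘ κ ∈ N^⊥ ⊗ ℚ̄}` because the pull-back of `P_κ`
to `B_N` is the push-out of `B_N^♮` along `κ|_{N}` and `B_N^♮` is anti-affine). The fact is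
Thm. 6.15 of Baker–Wüstholz (*a proper semistable analytic subgroup `B` of a commutative group
variety, both defined over a number field, has `B(ℚ̄) = 0`*) for `M_κ` and
`B = exp_{M_κ}(𝔟_ℂ)`, `𝔟 ⊊ Lie M_κ` a `ℚ̄`-subspace semistable in `M_κ`: every `w ∈ 𝔟_ℂ` with
`exp(w)` algebraic lies in `ker exp_{M_κ}`. It is the quotient-free form of
`semistabilityTheorem_GaGmE` (which it implies, `semistabilityTheorem_GaGmE_of_std`, proved) and
the target of the Baker–Wüstholz analytic argument (op. cit. §6.8 with Thm. 6.14); users take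
`(h : semistabilityTheorem_std)`.
[cite: BakerWustholz2007, Thm. 6.15 (Semistability Theorem); §6.7; §6.8] [cite: HuberWustholz2022, Prop. 4.18, Def. 4.19, Prop. 4.20 (vector extensions as push-outs of the universal one)] [cite: Brion2009, Prop. 3.3] -/
def semistabilityTheorem_std : Prop :=
  ∀ (L : PeriodPair), IsAlgebraic ℚ L.g₂ → IsAlgebraic ℚ L.g₃ → ¬ L.HasCM →
    ∀ (β γ δ : Type) [Fintype β] [Fintype γ] [Fintype δ] (κM : δ → γ → GaGmE.Kbar)
      (𝔟 : Submodule ℂ (β ⊕ (γ ⊕ δ) → ℂ)), LiePresentation.IsKRational GaGmE.Kbar 𝔟 → 𝔟 ≠ ⊤ →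
      GaGmE.Std.Semistable κM 𝔟 → ∀ w ∈ 𝔟, w ∈ GaGmE.Std.Alg L κM → w ∈ GaGmE.Std.ker L κM

namespace GaGmE

/-! ### Coordinates on `G/H` adapted to `H` -/

section Transport

variable {ι κ : Type} [Fintype ι] [Fintype κ]

/-- **Coordinates of `Lie(G/H)` adapted to `H = H_{(A₀, C₀, Ξ₀)}`**: unimodular integer bases
`q⁽ʲ⁾` of the characters `A₀` and `c⁽ᵇ⁾` of the homomorphisms `C₀` (spanning them over `ℚ`, with
`p ↦ (q⁽ʲ⁾ · p)ⱼ` onto `ℤⁿ`), a `ℚ̄`-basis `ξ⁽ᵉ⁾` of `Ξ₀`, and the matrix `κ` with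
`ξ⁽ᵉ⁾_t = ∑_b κ_{eb} c⁽ᵇ⁾` (compatibility). The quotient `G/H` is then `M_κ` with Lie
coordinates `y'_j = q⁽ʲ⁾ · y`, `z'_b = c⁽ᵇ⁾ · z`, `s_e = ξ⁽ᵉ⁾(x, t)`. [folklore] -/
structure QuotData (D₀ : SubgroupData ι κ) where
  /-- number of `𝔾ₘ`-coordinates of `G/H` -/
  nA : ℕ
  /-- the integer characters `q⁽ʲ⁾` -/
  qv : Fin nA → ι → ℤ
  qv_mem : ∀ j, (fun i => (qv j i : ℚ)) ∈ D₀.A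
  qv_span : ∀ q ∈ D₀.A, q ∈ Submodule.span ℚ (Set.range fun j i => (qv j i : ℚ))
  qv_unimod : ∀ t : Fin nA → ℤ, ∃ p : ι → ℤ, ∀ j, ∑ i, qv j i * p i = t j
  /-- number of `E`-coordinates of `G/H` -/
  nC : ℕ
  /-- the integer homomorphisms `c⁽ᵇ⁾` -/
  cv : Fin nC → κ → ℤ
  cv_mem : ∀ b, (fun k => (cv b k : ℚ)) ∈ D₀.C
  cv_span : ∀ c ∈ D₀.C, c ∈ Submodule.span ℚ (Set.range fun b k => (cv b k : ℚ))
  cv_unimod : ∀ t : Fin nC → ℤ, ∃ p : κ → ℤ, ∀ b, ∑ k, cv b k * p k = t b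
  /-- number of vector-group coordinates of `G/H` -/
  nΞ : ℕ
  /-- the additive characters `ξ⁽ᵉ⁾` -/
  ξv : Fin nΞ → Unit ⊕ κ → Kbar
  ξv_mem : ∀ e, ξv e ∈ D₀.Ξ
  ξv_span : ∀ ξ ∈ D₀.Ξ, ξ ∈ Submodule.span Kbar (Set.range ξv)
  ξv_indep : LinearIndependent Kbar ξv
  /-- the push-out matrix `κ` -/
  κM : Fin nΞ → Fin nC → Kbar
  κM_spec : ∀ e k, ξv e (Sum.inr k) = ∑ b, κM e b * (cv b k : Kbar)

/-- Adapted coordinates exist. [folklore] -/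
theorem nonempty_quotData (D₀ : SubgroupData ι κ) : Nonempty (QuotData D₀) := by
  classical
  obtain ⟨nA, qv, qv_mem, qv_span, qv_unimod⟩ := exists_unimodular_basis D₀.A
  obtain ⟨nC, cv, cv_mem, cv_span, cv_unimod⟩ := exists_unimodular_basis D₀.C
  -- a basis of `Ξ₀`
  let bΞ := Module.finBasis Kbar D₀.Ξ
  set nΞ := finrank Kbar D₀.Ξ
  let ξv : Fin nΞ → Unit ⊕ κ → Kbar := fun e => (bΞ e : Unit ⊕ κ → Kbar)
  have ξv_mem : ∀ e, ξv e ∈ D₀.Ξ := fun e => (bΞ e).2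
  have ξv_span : ∀ ξ ∈ D₀.Ξ, ξ ∈ Submodule.span Kbar (Set.range ξv) := by
    intro ξ hξ
    have e : ξ = ∑ e, (bΞ.repr ⟨ξ, hξ⟩ e) • ξv e := by
      have h := congrArg (fun x : D₀.Ξ => (x : Unit ⊕ κ → Kbar)) (bΞ.sum_repr ⟨ξ, hξ⟩)
      simp only [Submodule.coe_sum, Submodule.coe_smul] at h
      exact h.symm
    rw [e]
    exact Submodule.sum_mem _ fun e _ => Submodule.smul_mem _ _ (Submodule.subset_span ⟨e, rfl⟩)
  have ξv_indep : LinearIndependent Kbar ξv :=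
    bΞ.linearIndependent.map' D₀.Ξ.subtype (Submodule.ker_subtype _)
  -- the matrix `κ`: `(ξv e)_t ∈ span_K C₀ = span_K {cv b}`
  have hspanC : Submodule.span Kbar ((fun c : κ → ℚ => fun k => (c k : Kbar)) '' (D₀.C : Set (κ → ℚ)))
      ≤ Submodule.span Kbar (Set.range fun b k => (cv b k : Kbar)) := by
    rw [Submodule.span_le]
    rintro _ ⟨c, hc, rfl⟩
    have hc' := cv_span c hc
    rw [Submodule.mem_span_range_iff_exists_fun] at hc'
    obtain ⟨r, hr⟩ := hc'
    have e : (fun k => (c k : Kbar)) = ∑ b, (r b : Kbar) • fun k => (cv b k : Kbar) := by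
      funext k
      have := congr_fun hr k
      simp only [Finset.sum_apply, Pi.smul_apply, smul_eq_mul] at this ⊢
      rw [← this]
      push_cast
      rfl
    show (fun k => (c k : Kbar)) ∈ _
    rw [e]
    exact Submodule.sum_mem _ fun b _ => Submodule.smul_mem _ _ (Submodule.subset_span ⟨b, rfl⟩)
  have hκ : ∀ e, ∃ r : Fin nC → Kbar, (∑ b, r b • fun k => (cv b k : Kbar)) = fun k => ξv e (Sum.inr k) := by
    intro e
    have := hspanC (D₀.compat (ξv e) (ξv_mem e))
    rwa [Submodule.mem_span_range_iff_exists_fun] at this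
  choose κM hκM using hκ
  refine ⟨⟨nA, qv, qv_mem, qv_span, qv_unimod, nC, cv, cv_mem, cv_span, cv_unimod, nΞ, ξv,
    ξv_mem, ξv_span, ξv_indep, κM, fun e k => ?_⟩⟩
  have := congr_fun (hκM e) k
  simp only [Finset.sum_apply, Pi.smul_apply, smul_eq_mul] at this
  exact this.symm

namespace QuotData

variable {D₀ : SubgroupData ι κ} (Q : QuotData D₀)

/-- The index type of the coordinates of `Lie(G/H)`. [folklore] -/
abbrev σ' : Type := Fin Q.nA ⊕ (Fin Q.nC ⊕ Fin Q.nΞ)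

/-- The quotient map `Φ : Lie G → Lie(G/H) = Lie M_κ` in adapted coordinates. [folklore] -/
def Φ : (Unit ⊕ (ι ⊕ (κ ⊕ κ)) → ℂ) →ₗ[ℂ] (Q.σ' → ℂ) where
  toFun w := Std.coords (fun j => ∑ i, (Q.qv j i : ℂ) * w (iy i))
    (fun b => ∑ k, (Q.cv b k : ℂ) * w (iz k))
    (fun e => (Q.ξv e (Sum.inl ()) : ℂ) * w ix + ∑ k, (Q.ξv e (Sum.inr k) : ℂ) * w (it k))
  map_add' v w := by
    funext x
    rcases x with j | b | e
    · simp only [Std.coords, Sum.elim_inl, Pi.add_apply, mul_add, Finset.sum_add_distrib]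
    · simp only [Std.coords, Sum.elim_inr, Sum.elim_inl, Pi.add_apply, mul_add,
        Finset.sum_add_distrib]
    · simp only [Std.coords, Sum.elim_inr, Pi.add_apply, mul_add, Finset.sum_add_distrib]
      ring
  map_smul' c w := by
    funext x
    rcases x with j | b | e
    · simp only [Std.coords, Sum.elim_inl, Pi.smul_apply, smul_eq_mul, RingHom.id_apply,
        Finset.mul_sum]
      exact Finset.sum_congr rfl fun i _ => by ring
    · simp only [Std.coords, Sum.elim_inr, Sum.elim_inl, Pi.smul_apply, smul_eq_mul,
        RingHom.id_apply, Finset.mul_sum]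
      exact Finset.sum_congr rfl fun i _ => by ring
    · simp only [Std.coords, Sum.elim_inr, Pi.smul_apply, smul_eq_mul, RingHom.id_apply,
        Finset.mul_sum, mul_add]
      congr 1
      · ring
      · exact Finset.sum_congr rfl fun k _ => by ring

/-- The `y'`-block of `Φ`. [folklore] -/
theorem Φ_iy (w) (j : Fin Q.nA) : Q.Φ w (Std.iy j) = ∑ i, (Q.qv j i : ℂ) * w (iy i) := rfl
/-- The `z'`-block of `Φ`. [folklore] -/
theorem Φ_iz (w) (b : Fin Q.nC) : Q.Φ w (Std.iz b) = ∑ k, (Q.cv b k : ℂ) * w (iz k) := rfl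
/-- The `s`-block of `Φ`. [folklore] -/
theorem Φ_is (w) (e : Fin Q.nΞ) : Q.Φ w (Std.is e) =
    (Q.ξv e (Sum.inl ()) : ℂ) * w ix + ∑ k, (Q.ξv e (Sum.inr k) : ℂ) * w (it k) := rfl

/-- `ker Φ = Lie H`. [folklore] -/
theorem Φ_eq_zero_iff (w : Unit ⊕ (ι ⊕ (κ ⊕ κ)) → ℂ) : Q.Φ w = 0 ↔ w ∈ D₀.tangent := by
  rw [SubgroupData.mem_tangent_iff]
  constructor
  · intro h
    have hy : ∀ j, ∑ i, (Q.qv j i : ℂ) * w (iy i) = 0 := fun j => by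
      have := congr_fun h (Std.iy j); rwa [Φ_iy] at this
    have hz : ∀ b, ∑ k, (Q.cv b k : ℂ) * w (iz k) = 0 := fun b => by
      have := congr_fun h (Std.iz b); rwa [Φ_iz] at this
    have hs : ∀ e, (Q.ξv e (Sum.inl ()) : ℂ) * w ix + ∑ k, (Q.ξv e (Sum.inr k) : ℂ) * w (it k) = 0 :=
      fun e => by have := congr_fun h (Std.is e); rwa [Φ_is] at this
    refine ⟨fun q hq => ?_, fun c hc => ?_, fun ξ hξ => ?_⟩
    · have hq' := Q.qv_span q hq
      rw [Submodule.mem_span_range_iff_exists_fun] at hq'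
      obtain ⟨r, rfl⟩ := hq'
      simp only [Finset.sum_apply, Pi.smul_apply, smul_eq_mul, Rat.cast_sum, Rat.cast_mul,
        Rat.cast_intCast, Finset.sum_mul]
      rw [Finset.sum_comm]
      refine Finset.sum_eq_zero fun j _ => ?_
      have := congrArg (fun x => (r j : ℂ) * x) (hy j)
      simpa [Finset.mul_sum, mul_assoc] using this
    · have hc' := Q.cv_span c hc
      rw [Submodule.mem_span_range_iff_exists_fun] at hc'
      obtain ⟨r, rfl⟩ := hc'
      simp only [Finset.sum_apply, Pi.smul_apply, smul_eq_mul, Rat.cast_sum, Rat.cast_mul,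
        Rat.cast_intCast, Finset.sum_mul]
      rw [Finset.sum_comm]
      refine Finset.sum_eq_zero fun b _ => ?_
      have := congrArg (fun x => (r b : ℂ) * x) (hz b)
      simpa [Finset.mul_sum, mul_assoc] using this
    · have hξ' := Q.ξv_span ξ hξ
      rw [Submodule.mem_span_range_iff_exists_fun] at hξ'
      obtain ⟨r, rfl⟩ := hξ'
      have : ∑ e, (r e : ℂ) * ((Q.ξv e (Sum.inl ()) : ℂ) * w ix +
          ∑ k, (Q.ξv e (Sum.inr k) : ℂ) * w (it k)) = 0 :=
        Finset.sum_eq_zero fun e _ => by rw [hs e, mul_zero]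
      rw [← this]
      simp only [Finset.sum_apply, Pi.smul_apply, smul_eq_mul]
      push_cast
      simp only [Finset.sum_mul, mul_add, Finset.mul_sum, Finset.sum_add_distrib]
      congr 1
      · exact Finset.sum_congr rfl fun e _ => by ring
      · rw [Finset.sum_comm]
        exact Finset.sum_congr rfl fun e _ => Finset.sum_congr rfl fun k _ => by ring
  · rintro ⟨hA, hC, hΞ⟩
    funext x
    rcases x with j | b | e
    · show Q.Φ w (Std.iy j) = 0
      rw [Φ_iy]
      simpa using hA _ (Q.qv_mem j)
    · show Q.Φ w (Std.iz b) = 0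
      rw [Φ_iz]
      simpa using hC _ (Q.cv_mem b)
    · show Q.Φ w (Std.is e) = 0
      rw [Φ_is]
      exact hΞ _ (Q.ξv_mem e)

/-- `ker Φ = Lie H` as submodules. [folklore] -/
theorem ker_Φ : LinearMap.ker Q.Φ = D₀.tangent := by
  ext w
  rw [LinearMap.mem_ker, Φ_eq_zero_iff]

/-- `Φ` is surjective. [folklore] -/
theorem Φ_surjective : Function.Surjective Q.Φ := by
  classical
  intro x
  -- `y`-block and `z`-block by unimodularity, `s`-block by linear independence
  choose py hpy using fun j => Q.qv_unimod (Pi.single j 1)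
  choose pz hpz using fun b => Q.cv_unimod (Pi.single b 1)
  -- the `s`-block map is onto
  let Ψ : (Unit ⊕ κ → ℂ) →ₗ[ℂ] (Fin Q.nΞ → ℂ) :=
    { toFun := fun v e => ∑ s, (Q.ξv e s : ℂ) * v s
      map_add' := fun v v' => by
        funext e; simp [mul_add, Finset.sum_add_distrib]
      map_smul' := fun c v => by
        funext e
        simp only [Pi.smul_apply, smul_eq_mul, RingHom.id_apply, Finset.mul_sum]
        exact Finset.sum_congr rfl fun s _ => by ring }
  have hΨs : ∀ s e, Ψ (Pi.single s 1) e = (Q.ξv e s : ℂ) := fun s e => by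
    simp only [Ψ, LinearMap.coe_mk, AddHom.coe_mk]
    rw [Finset.sum_eq_single s (fun s' _ hs' => by simp [Pi.single_eq_of_ne hs'])
      (fun h => absurd (Finset.mem_univ s) h)]
    simp
  have hΨ : Function.Surjective Ψ := by
    rw [← LinearMap.range_eq_top]
    by_contra hne
    obtain ⟨f, hf0, hle⟩ := Submodule.exists_le_ker_of_lt_top _ (lt_top_iff_ne_top.mpr hne)
    apply hf0
    -- `f = ∑ c_e · coordinate e`; the `c_e` give a `ℂ`-relation among the `ξv e`
    let c : Fin Q.nΞ → ℂ := fun e => f (Pi.single e 1)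
    have hf : ∀ u : Fin Q.nΞ → ℂ, f u = ∑ e, c e * u e := by
      intro u
      conv_lhs => rw [pi_eq_sum_univ u]
      simp only [map_sum, map_smul, smul_eq_mul, c]
      refine Finset.sum_congr rfl fun e _ => ?_
      rw [mul_comm]
      congr 2
      funext e'
      simp [Pi.single_apply, eq_comm]
    have hrel : ∑ e, c e • (fun s => (Q.ξv e s : ℂ)) = 0 := by
      funext s
      have hmem : Ψ (Pi.single s 1) ∈ LinearMap.range Ψ := LinearMap.mem_range_self _ _
      have := hle hmem
      rw [LinearMap.mem_ker, hf] at this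
      simp only [Finset.sum_apply, Pi.smul_apply, smul_eq_mul, Pi.zero_apply]
      rw [← this]
      exact Finset.sum_congr rfl fun e _ => by rw [hΨs]
    have hind := linearIndependent_ofK (L := ℂ) Q.ξv_indep
    have hc0 : ∀ e, c e = 0 := by
      have := Fintype.linearIndependent_iff.mp hind c (by
        rw [← hrel]
        refine Finset.sum_congr rfl fun e _ => ?_
        rfl)
      exact this
    refine LinearMap.ext fun u => ?_
    rw [hf]
    simp [hc0]
  obtain ⟨v, hv⟩ := hΨ fun e => x (Std.is e)
  refine ⟨lieCoords (v (Sum.inl ())) (fun i => ∑ j, x (Std.iy j) * (py j i : ℂ))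
    (fun k => ∑ b, x (Std.iz b) * (pz b k : ℂ)) (fun k => v (Sum.inr k)), ?_⟩
  funext s
  rcases s with j | b | e
  · show Q.Φ _ (Std.iy j) = x (Std.iy j)
    rw [Φ_iy]
    simp only [iy, lieCoords_inr_inl]
    -- ∑_i q_j i * ∑_j' x_j' p_j' i = ∑_j' x_j' (q_j · p_j') = x_j
    have key : ∀ j', ∑ i, (Q.qv j i : ℂ) * (py j' i : ℂ) = if j = j' then 1 else 0 := by
      intro j'
      have := hpy j' j
      have h := congrArg (fun n : ℤ => (n : ℂ)) this
      push_cast at h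
      rw [h, Pi.single_apply]
      split_ifs <;> simp
    calc ∑ i, (Q.qv j i : ℂ) * ∑ j', x (Std.iy j') * (py j' i : ℂ)
        = ∑ j', x (Std.iy j') * ∑ i, (Q.qv j i : ℂ) * (py j' i : ℂ) := by
          simp only [Finset.mul_sum]
          rw [Finset.sum_comm]
          exact Finset.sum_congr rfl fun j' _ => Finset.sum_congr rfl fun i _ => by ring
      _ = x (Std.iy j) := by
          simp only [key, mul_ite, mul_one, mul_zero, Finset.sum_ite_eq, Finset.mem_univ, if_true]
  · show Q.Φ _ (Std.iz b) = x (Std.iz b)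
    rw [Φ_iz]
    simp only [iz, lieCoords_inr_inr_inl]
    have key : ∀ b', ∑ k, (Q.cv b k : ℂ) * (pz b' k : ℂ) = if b = b' then 1 else 0 := by
      intro b'
      have := hpz b' b
      have h := congrArg (fun n : ℤ => (n : ℂ)) this
      push_cast at h
      rw [h, Pi.single_apply]
      split_ifs <;> simp
    calc ∑ k, (Q.cv b k : ℂ) * ∑ b', x (Std.iz b') * (pz b' k : ℂ)
        = ∑ b', x (Std.iz b') * ∑ k, (Q.cv b k : ℂ) * (pz b' k : ℂ) := by
          simp only [Finset.mul_sum]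
          rw [Finset.sum_comm]
          exact Finset.sum_congr rfl fun b' _ => Finset.sum_congr rfl fun k _ => by ring
      _ = x (Std.iz b) := by
          simp only [key, mul_ite, mul_one, mul_zero, Finset.sum_ite_eq, Finset.mem_univ, if_true]
  · have := congr_fun hv e
    simp only [Ψ, LinearMap.coe_mk, AddHom.coe_mk] at this
    show Q.Φ _ (Std.is e) = x (Std.is e)
    rw [Φ_is]
    simp only [ix, it, lieCoords_inl, lieCoords_inr_inr_inr]
    rw [← this]
    simp [Fintype.sum_sum_type]

/-- Dimension of preimages: `dim Φ⁻¹(X) = dim X + dim Lie H`. [folklore] -/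
theorem finrank_comap (X : Submodule ℂ (Q.σ' → ℂ)) :
    finrank ℂ ↥(X.comap Q.Φ) = finrank ℂ X + finrank ℂ ↥D₀.tangent := by
  let Φ' := Q.Φ.domRestrict (X.comap Q.Φ)
  have hrange : LinearMap.range Φ' = X := by
    apply le_antisymm
    · rintro _ ⟨⟨w, hw⟩, rfl⟩
      exact hw
    · intro x hx
      obtain ⟨w, rfl⟩ := Q.Φ_surjective x
      exact ⟨⟨w, hx⟩, rfl⟩
  have hker : finrank ℂ ↥(LinearMap.ker Φ') = finrank ℂ ↥D₀.tangent := by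
    rw [LinearMap.ker_domRestrict, Q.ker_Φ]
    have hle : D₀.tangent ≤ X.comap Q.Φ := by
      intro w hw
      rw [Submodule.mem_comap, (Q.Φ_eq_zero_iff w).mpr hw]
      exact X.zero_mem
    exact (Submodule.comapSubtypeEquivOfLe hle).finrank_eq
  have := LinearMap.finrank_range_add_finrank_ker Φ'
  rw [hrange, hker] at this
  exact this.symm

/-- `Φ⁻¹(Φ(𝔟)) = 𝔟` when `Lie H ⊆ 𝔟`. [folklore] -/
theorem comap_map {𝔟 : Submodule ℂ ((Unit ⊕ (ι ⊕ (κ ⊕ κ))) → ℂ)} (h : D₀.tangent ≤ 𝔟) :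
    (𝔟.map Q.Φ).comap Q.Φ = 𝔟 :=
  Submodule.comap_map_eq_self (by rw [Q.ker_Φ]; exact h)

/-- The same map over `K = ℚ̄`. [folklore] -/
def ΦK (w : Unit ⊕ (ι ⊕ (κ ⊕ κ)) → Kbar) : Q.σ' → Kbar :=
  Std.coords (fun j => ∑ i, (Q.qv j i : Kbar) * w (iy i))
    (fun b => ∑ k, (Q.cv b k : Kbar) * w (iz k))
    (fun e => Q.ξv e (Sum.inl ()) * w ix + ∑ k, Q.ξv e (Sum.inr k) * w (it k))

/-- `Φ` is defined over `K`. [folklore] -/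
theorem Φ_ofK (w : Unit ⊕ (ι ⊕ (κ ⊕ κ)) → Kbar) :
    Q.Φ (LiePresentation.ofK Kbar w) = LiePresentation.ofK Kbar (Q.ΦK w) := by
  funext s
  rcases s with j | b | e
  · show Q.Φ _ (Std.iy j) = algebraMap Kbar ℂ (Q.ΦK w (Std.iy j))
    rw [Φ_iy]
    simp [ΦK, LiePresentation.ofK, map_sum, map_mul, iy]
  · show Q.Φ _ (Std.iz b) = algebraMap Kbar ℂ (Q.ΦK w (Std.iz b))
    rw [Φ_iz]
    simp [ΦK, LiePresentation.ofK, map_sum, map_mul, iz]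
  · show Q.Φ _ (Std.is e) = algebraMap Kbar ℂ (Q.ΦK w (Std.is e))
    rw [Φ_is]
    simp [ΦK, LiePresentation.ofK, map_sum, map_mul, map_add, ix, it]

/-- Images of `K`-rational subspaces are `K`-rational. [folklore] -/
theorem isKRational_map {𝔟 : Submodule ℂ ((Unit ⊕ (ι ⊕ (κ ⊕ κ))) → ℂ)}
    (h : LiePresentation.IsKRational Kbar 𝔟) : LiePresentation.IsKRational Kbar (𝔟.map Q.Φ) := by
  obtain ⟨S, rfl⟩ := h
  refine ⟨Q.ΦK '' S, ?_⟩
  rw [Submodule.map_span, Set.image_image, Set.image_image]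
  congr 1
  exact Set.image_congr fun w _ => Q.Φ_ofK w

end QuotData

namespace QuotData

variable {D₀ : SubgroupData ι κ} (Q : QuotData D₀)

/-! #### Pull-back of subgroups of `G/H` to subgroups of `G` containing `H` -/

/-- The `ℚ`-linear map `q' ↦ ∑_j q'_j q⁽ʲ⁾`. [folklore] -/
def qLin : (Fin Q.nA → ℚ) →ₗ[ℚ] (ι → ℚ) where
  toFun q' := fun i => ∑ j, q' j * (Q.qv j i : ℚ)
  map_add' a b := by funext i; simp [add_mul, Finset.sum_add_distrib]
  map_smul' c a := by funext i; simp [Finset.mul_sum, mul_assoc]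

/-- The `ℚ`-linear map `c' ↦ ∑_b c'_b c⁽ᵇ⁾`. [folklore] -/
def cLin : (Fin Q.nC → ℚ) →ₗ[ℚ] (κ → ℚ) where
  toFun c' := fun k => ∑ b, c' b * (Q.cv b k : ℚ)
  map_add' a b := by funext i; simp [add_mul, Finset.sum_add_distrib]
  map_smul' c a := by funext i; simp [Finset.mul_sum, mul_assoc]

/-- The `K`-linear map `ξ' ↦ ∑_e ξ'_e ξ⁽ᵉ⁾`. [folklore] -/
def ξLin : (Fin Q.nΞ → Kbar) →ₗ[Kbar] (Unit ⊕ κ → Kbar) where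
  toFun ξ' := ∑ e, ξ' e • Q.ξv e
  map_add' a b := by simp [add_smul, Finset.sum_add_distrib]
  map_smul' c a := by simp [Finset.smul_sum, smul_smul]

/-- The connected algebraic subgroup `K ⊇ H` of `G` corresponding to a connected algebraic
subgroup `K/H` of `G/H = M_κ`. [folklore] -/
def pull (D' : Std.SubgroupData (Fin Q.nA) (Fin Q.nC) (Fin Q.nΞ) Q.κM) : SubgroupData ι κ where
  A := D'.A.map Q.qLin
  C := D'.C.map Q.cLin
  Ξ := D'.Ξ.map Q.ξLin
  compat := by
    classical
    rintro _ ⟨ξ', hξ', rfl⟩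
    have hc := D'.compat ξ' hξ'
    -- the `t`-part of `ξLin ξ'` is `∑_b (ξ' κ)_b • c⁽ᵇ⁾`
    have ht : (fun k => Q.ξLin ξ' (Sum.inr k)) =
        ∑ b, (∑ e, ξ' e * Q.κM e b) • fun k => (Q.cv b k : Kbar) := by
      funext k
      simp only [ξLin, LinearMap.coe_mk, AddHom.coe_mk, Finset.sum_apply, Pi.smul_apply,
        smul_eq_mul, Q.κM_spec, Finset.mul_sum, Finset.sum_mul]
      rw [Finset.sum_comm]
      exact Finset.sum_congr rfl fun b _ => Finset.sum_congr rfl fun e _ => by ring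
    rw [ht]
    -- by `span_induction` on `hc`: `∑_b λ_b • c⁽ᵇ⁾ ∈ span (image of C)` for `λ ∈ span (image of C')`
    have key : ∀ lam ∈ Submodule.span Kbar
        ((fun c : Fin Q.nC → ℚ => fun b => (c b : Kbar)) '' (D'.C : Set (Fin Q.nC → ℚ))),
        (∑ b, lam b • fun k => (Q.cv b k : Kbar)) ∈ Submodule.span Kbar
          ((fun c : κ → ℚ => fun k => (c k : Kbar)) '' ((D'.C.map Q.cLin : Submodule ℚ (κ → ℚ)) :
            Set (κ → ℚ))) := by
      intro lam hlam
      induction hlam using Submodule.span_induction with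
      | mem x hx =>
        obtain ⟨c', hc', rfl⟩ := hx
        refine Submodule.subset_span ⟨Q.cLin c', ⟨c', hc', rfl⟩, ?_⟩
        funext k
        simp [cLin, Finset.sum_apply, Pi.smul_apply]
      | zero => simp
      | add x y _ _ hx hy =>
        simp only [Pi.add_apply, add_smul, Finset.sum_add_distrib]
        exact Submodule.add_mem _ hx hy
      | smul r x _ hx =>
        simp only [Pi.smul_apply, smul_eq_mul, ← smul_smul, ← Finset.smul_sum]
        exact Submodule.smul_mem _ _ hx
    exact key _ hc

/-- `Φ⁻¹(Lie(K/H)) = Lie K`. [folklore] -/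
theorem comap_tangent (D' : Std.SubgroupData (Fin Q.nA) (Fin Q.nC) (Fin Q.nΞ) Q.κM) :
    D'.tangent.comap Q.Φ = (Q.pull D').tangent := by
  ext w
  rw [Submodule.mem_comap, Std.SubgroupData.mem_tangent_iff, SubgroupData.mem_tangent_iff]
  simp only [pull, Submodule.mem_map]
  constructor
  · rintro ⟨hA, hC, hΞ⟩
    refine ⟨?_, ?_, ?_⟩
    · rintro _ ⟨q', hq', rfl⟩
      have := hA q' hq'
      simp only [Φ_iy] at this
      simp only [qLin, LinearMap.coe_mk, AddHom.coe_mk, Rat.cast_sum, Rat.cast_mul,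
        Rat.cast_intCast, Finset.sum_mul]
      rw [Finset.sum_comm, ← this]
      simp only [Finset.mul_sum]
      exact Finset.sum_congr rfl fun j _ => Finset.sum_congr rfl fun i _ => by ring
    · rintro _ ⟨c', hc', rfl⟩
      have := hC c' hc'
      simp only [Φ_iz] at this
      simp only [cLin, LinearMap.coe_mk, AddHom.coe_mk, Rat.cast_sum, Rat.cast_mul,
        Rat.cast_intCast, Finset.sum_mul]
      rw [Finset.sum_comm, ← this]
      simp only [Finset.mul_sum]
      exact Finset.sum_congr rfl fun b _ => Finset.sum_congr rfl fun k _ => by ring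
    · rintro _ ⟨ξ', hξ', rfl⟩
      have := hΞ ξ' hξ'
      simp only [Φ_is] at this
      rw [← this]
      simp only [ξLin, LinearMap.coe_mk, AddHom.coe_mk, Finset.sum_apply, Pi.smul_apply,
        smul_eq_mul]
      push_cast
      simp only [Finset.sum_mul, mul_add, Finset.mul_sum, Finset.sum_add_distrib]
      congr 1
      · exact Finset.sum_congr rfl fun e _ => by ring
      · rw [Finset.sum_comm]
        exact Finset.sum_congr rfl fun e _ => Finset.sum_congr rfl fun k _ => by ring
  · rintro ⟨hA, hC, hΞ⟩
    refine ⟨fun q' hq' => ?_, fun c' hc' => ?_, fun ξ' hξ' => ?_⟩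
    · have := hA _ ⟨q', hq', rfl⟩
      simp only [qLin, LinearMap.coe_mk, AddHom.coe_mk, Rat.cast_sum, Rat.cast_mul,
        Rat.cast_intCast, Finset.sum_mul] at this
      rw [Finset.sum_comm] at this
      simp only [Φ_iy, Finset.mul_sum]
      rw [← this]
      exact Finset.sum_congr rfl fun j _ => Finset.sum_congr rfl fun i _ => by ring
    · have := hC _ ⟨c', hc', rfl⟩
      simp only [cLin, LinearMap.coe_mk, AddHom.coe_mk, Rat.cast_sum, Rat.cast_mul,
        Rat.cast_intCast, Finset.sum_mul] at this
      rw [Finset.sum_comm] at this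
      simp only [Φ_iz, Finset.mul_sum]
      rw [← this]
      exact Finset.sum_congr rfl fun b _ => Finset.sum_congr rfl fun k _ => by ring
    · have := hΞ _ ⟨ξ', hξ', rfl⟩
      rw [← this]
      simp only [Φ_is, ξLin, LinearMap.coe_mk, AddHom.coe_mk, Finset.sum_apply, Pi.smul_apply,
        smul_eq_mul]
      push_cast
      simp only [Finset.sum_mul, mul_add, Finset.mul_sum, Finset.sum_add_distrib]
      congr 1
      · exact Finset.sum_congr rfl fun e _ => by ring
      · rw [Finset.sum_comm]
        exact Finset.sum_congr rfl fun e _ => Finset.sum_congr rfl fun k _ => by ring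

/-- `Lie H ⊆ Lie K`. [folklore] -/
theorem tangent_le_pull (D' : Std.SubgroupData (Fin Q.nA) (Fin Q.nC) (Fin Q.nΞ) Q.κM) :
    D₀.tangent ≤ (Q.pull D').tangent := by
  intro w hw
  rw [← comap_tangent, Submodule.mem_comap, (Q.Φ_eq_zero_iff w).mpr hw]
  exact Submodule.zero_mem _

/-- `K ≠ G` if `K/H ≠ G/H`. [folklore] -/
theorem pull_ne_top {D' : Std.SubgroupData (Fin Q.nA) (Fin Q.nC) (Fin Q.nΞ) Q.κM}
    (h : D'.tangent ≠ ⊤) : (Q.pull D').tangent ≠ ⊤ := by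
  intro htop
  apply h
  rw [eq_top_iff]
  intro x _
  obtain ⟨w, rfl⟩ := Q.Φ_surjective x
  have : w ∈ (Q.pull D').tangent := by rw [htop]; exact Submodule.mem_top
  rw [← comap_tangent, Submodule.mem_comap] at this
  exact this

/-! #### Algebraic points and the kernel under `Φ` -/

/-- Integer powers of algebraic numbers are algebraic. [folklore] -/
theorem _root_.Literature.NumberTheory.Transcendental.isAlgebraic_zpow {x : ℂ} (hx : IsAlgebraic ℚ x) (n : ℤ) :
    IsAlgebraic ℚ (x ^ n) := by
  cases n with
  | ofNat k => rw [Int.ofNat_eq_natCast, zpow_natCast]; exact hx.pow k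
  | negSucc k => rw [zpow_negSucc]; exact (hx.pow _).inv

/-- Integer combinations of `ℚ̄`-points of `E♮` are `ℚ̄`-points. [folklore] -/
theorem _root_.PeriodPair.IsUnivExtAlgPoint.sum_int_mul {L : PeriodPair} (h₂ : IsAlgebraic ℚ L.g₂)
    (h₃ : IsAlgebraic ℚ L.g₃) {α : Type*} (s : Finset α) (n : α → ℤ) (z t : α → ℂ)
    (h : ∀ a ∈ s, L.IsUnivExtAlgPoint (z a) (t a)) :
    L.IsUnivExtAlgPoint (∑ a ∈ s, (n a : ℂ) * z a) (∑ a ∈ s, (n a : ℂ) * t a) := by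
  classical
  induction s using Finset.induction_on with
  | empty => simpa using L.isUnivExtAlgPoint_zero
  | insert a s ha ih =>
    rw [Finset.sum_insert ha, Finset.sum_insert ha]
    exact ((h a (Finset.mem_insert_self a s)).int_mul h₂ h₃ (n a)).add h₂ h₃
      (ih fun a' ha' => h a' (Finset.mem_insert_of_mem ha'))

/-- `Φ` maps `exp_G⁻¹(G(ℚ̄))` into `exp_{M_κ}⁻¹(M_κ(ℚ̄))`. [folklore] -/
theorem Φ_mem_Alg {L : PeriodPair} (h₂ : IsAlgebraic ℚ L.g₂) (h₃ : IsAlgebraic ℚ L.g₃)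
    {w : Unit ⊕ (ι ⊕ (κ ⊕ κ)) → ℂ} (hw : w ∈ Alg L ι κ) : Q.Φ w ∈ Std.Alg L Q.κM := by
  obtain ⟨hx, hy, hzt⟩ := hw
  refine ⟨fun j => ?_, ⟨fun b => ∑ k, (Q.cv b k : ℂ) * w (it k), fun b => ?_, fun e => ?_⟩⟩
  · rw [Φ_iy, Complex.exp_sum]
    refine Finset.prod_induction _ (fun x => IsAlgebraic ℚ x) (fun a b ha hb => ha.mul hb)
      isAlgebraic_one fun i _ => ?_
    rw [Complex.exp_int_mul]
    exact isAlgebraic_zpow (hy i) _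
  · rw [Φ_iz]
    exact PeriodPair.IsUnivExtAlgPoint.sum_int_mul h₂ h₃ _ _ _ _ fun k _ => hzt k
  · rw [Φ_is]
    have e1 : (Q.ξv e (Sum.inl ()) : ℂ) * w ix + ∑ k, (Q.ξv e (Sum.inr k) : ℂ) * w (it k) -
        ∑ b, (Q.κM e b : ℂ) * ∑ k, (Q.cv b k : ℂ) * w (it k) = (Q.ξv e (Sum.inl ()) : ℂ) * w ix := by
      have hκ : ∀ k, (Q.ξv e (Sum.inr k) : ℂ) = ∑ b, (Q.κM e b : ℂ) * (Q.cv b k : ℂ) := by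
        intro k
        have := congrArg (algebraMap Kbar ℂ) (Q.κM_spec e k)
        simpa [map_sum, map_mul] using this
      have e2 : ∑ k, (∑ b, (Q.κM e b : ℂ) * (Q.cv b k : ℂ)) * w (it k) =
          ∑ b, (Q.κM e b : ℂ) * ∑ k, (Q.cv b k : ℂ) * w (it k) := by
        simp only [Finset.sum_mul, Finset.mul_sum]
        rw [Finset.sum_comm]
        exact Finset.sum_congr rfl fun b _ => Finset.sum_congr rfl fun k _ => by ring
      simp only [hκ]
      rw [e2]
      ring
    rw [e1]
    exact (mem_algebraicClosure_iff.mp (Q.ξv e (Sum.inl ())).2).mul hx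

/-- **Lifting the kernel** (unimodularity): if `Φ w ∈ ker(exp_{M_κ})` then `w ∈ ker(exp_G) + Lie H`.
[folklore] -/
theorem exists_ker_of_Φ_mem_ker {L : PeriodPair} {w : Unit ⊕ (ι ⊕ (κ ⊕ κ)) → ℂ}
    (hw : Q.Φ w ∈ Std.ker L Q.κM) : ∃ k ∈ ker L ι κ, w - k ∈ D₀.tangent := by
  obtain ⟨hy, m', n', hz, hs⟩ := hw
  choose p' hp' using hy
  obtain ⟨p, hp⟩ := Q.qv_unimod p'
  obtain ⟨m, hm⟩ := Q.cv_unimod m'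
  obtain ⟨n, hn⟩ := Q.cv_unimod n'
  refine ⟨lieCoords 0 (fun i => (p i : ℂ) * (2 * Real.pi * I))
    (fun k => (m k : ℂ) * L.ω₁ + (n k : ℂ) * L.ω₂) (fun k => (m k : ℂ) * L.η₁ + (n k : ℂ) * L.η₂),
    ⟨rfl, fun i => ⟨p i, rfl⟩, fun k => ⟨m k, n k, rfl, rfl⟩⟩, ?_⟩
  rw [← Q.Φ_eq_zero_iff, map_sub, sub_eq_zero]
  funext s
  rcases s with j | b | e
  · show Q.Φ w (Std.iy j) = Q.Φ _ (Std.iy j)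
    rw [hp' j, Φ_iy]
    simp only [iy, lieCoords_inr_inl]
    have := congrArg (fun x : ℤ => (x : ℂ)) (hp j)
    push_cast at this
    rw [← this, Finset.sum_mul]
    exact Finset.sum_congr rfl fun i _ => by ring
  · show Q.Φ w (Std.iz b) = Q.Φ _ (Std.iz b)
    rw [hz b, Φ_iz]
    simp only [iz, lieCoords_inr_inr_inl]
    have h1 := congrArg (fun x : ℤ => (x : ℂ)) (hm b)
    have h2 := congrArg (fun x : ℤ => (x : ℂ)) (hn b)
    push_cast at h1 h2
    rw [← h1, ← h2, Finset.sum_mul, Finset.sum_mul, ← Finset.sum_add_distrib]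
    exact Finset.sum_congr rfl fun k _ => by ring
  · show Q.Φ w (Std.is e) = Q.Φ _ (Std.is e)
    rw [hs e, Φ_is]
    simp only [ix, it, lieCoords_inl, lieCoords_inr_inr_inr, mul_zero, zero_add]
    have hκ : ∀ k, (Q.ξv e (Sum.inr k) : ℂ) = ∑ b, (Q.κM e b : ℂ) * (Q.cv b k : ℂ) := by
      intro k
      have := congrArg (algebraMap Kbar ℂ) (Q.κM_spec e k)
      simpa [map_sum, map_mul] using this
    have h1 : ∀ b, (m' b : ℂ) = ∑ k, (Q.cv b k : ℂ) * (m k : ℂ) := fun b => by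
      have := congrArg (fun x : ℤ => (x : ℂ)) (hm b); push_cast at this; exact this.symm
    have h2 : ∀ b, (n' b : ℂ) = ∑ k, (Q.cv b k : ℂ) * (n k : ℂ) := fun b => by
      have := congrArg (fun x : ℤ => (x : ℂ)) (hn b); push_cast at this; exact this.symm
    simp only [hκ, h1, h2, Finset.sum_mul, Finset.mul_sum, mul_add, Finset.sum_add_distrib]
    congr 1
    · rw [Finset.sum_comm]
      exact Finset.sum_congr rfl fun b _ => Finset.sum_congr rfl fun k _ => by ring
    · rw [Finset.sum_comm]
      exact Finset.sum_congr rfl fun b _ => Finset.sum_congr rfl fun k _ => by ring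

end QuotData

/-! ### The transport theorem -/

/-- **The Semistability Theorem for the quotients `G/H` follows from the Semistability Theorem
for the explicit groups `M_κ`** (`semistabilityTheorem_std → semistabilityTheorem_GaGmE`),
sorry-free: in the adapted coordinates `Φ` of `QuotData`, `𝔟 ↦ Φ(𝔟)` preserves
`ℚ̄`-rationality, properness and semistability (proper quotients `K/H` of `G/H` ↔ connected
`K ⊋ H` via `QuotData.pull`, with `dim Φ⁻¹(X) = dim X + dim Lie H`), algebraic points map to
algebraic points, and `ker(exp_{M_κ})` lifts to `ker(exp_G) + Lie H` because the chosen integer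
bases are unimodular. [cite: BakerWustholz2007, §6.8 (p. 115: passage to the quotient `G → G^*`)] -/
theorem semistabilityTheorem_GaGmE_of_std (hstd : semistabilityTheorem_std) :
    semistabilityTheorem_GaGmE := by
  intro L h₂ h₃ hCM ι κ _ _
  rintro _ ⟨D₀, rfl⟩ h𝔥top 𝔟 h𝔟rat h𝔥𝔟 h𝔟top hss w hw𝔟 hwAlg
  classical
  obtain ⟨Q⟩ := nonempty_quotData D₀
  set 𝔟' : Submodule ℂ (Q.σ' → ℂ) := 𝔟.map Q.Φ with h𝔟'
  have hcomap𝔟 : 𝔟'.comap Q.Φ = 𝔟 := Q.comap_map h𝔥𝔟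
  -- (T1) rationality, (T2) properness
  have h1 : LiePresentation.IsKRational Kbar 𝔟' := Q.isKRational_map h𝔟rat
  have h2 : 𝔟' ≠ ⊤ := by
    intro htop
    apply h𝔟top
    rw [← hcomap𝔟, htop, Submodule.comap_top]
  -- dimensions
  set h : ℕ := finrank ℂ ↥D₀.tangent
  have hdim𝔟 : finrank ℂ 𝔟 = finrank ℂ 𝔟' + h := by rw [← hcomap𝔟]; exact Q.finrank_comap 𝔟'
  have hcard : Fintype.card (Unit ⊕ (ι ⊕ (κ ⊕ κ))) = Fintype.card Q.σ' + h := by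
    have e1 : finrank ℂ ↥((⊤ : Submodule ℂ (Q.σ' → ℂ)).comap Q.Φ) =
        finrank ℂ (⊤ : Submodule ℂ (Q.σ' → ℂ)) + h := Q.finrank_comap ⊤
    rw [Submodule.comap_top, finrank_top, finrank_top, Module.finrank_fintype_fun_eq_card,
      Module.finrank_fintype_fun_eq_card] at e1
    exact e1
  -- (T3) semistability
  have h3 : Std.Semistable Q.κM 𝔟' := by
    rintro _ ⟨D', rfl⟩ h𝔨'top
    have hk := hss (Q.pull D').tangent ⟨Q.pull D', rfl⟩ (Q.tangent_le_pull D') (Q.pull_ne_top h𝔨'top)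
    have hdimK : finrank ℂ ↥(Q.pull D').tangent = finrank ℂ ↥D'.tangent + h := by
      rw [← Q.comap_tangent]; exact Q.finrank_comap _
    have hdimI : finrank ℂ ↥(𝔟 ⊓ (Q.pull D').tangent) = finrank ℂ ↥(𝔟' ⊓ D'.tangent) + h := by
      rw [← hcomap𝔟, ← Q.comap_tangent, ← Submodule.comap_inf]; exact Q.finrank_comap _
    -- `hk` is about the presentation's `Semistable`; unfold it
    change (finrank ℂ 𝔟 - finrank ℂ ↥D₀.tangent) *
        (Fintype.card (Unit ⊕ (ι ⊕ (κ ⊕ κ))) - finrank ℂ ↥(Q.pull D').tangent) ≤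
      (finrank ℂ 𝔟 - finrank ℂ ↥(𝔟 ⊓ (Q.pull D').tangent)) *
        (Fintype.card (Unit ⊕ (ι ⊕ (κ ⊕ κ))) - finrank ℂ ↥D₀.tangent) at hk
    rw [hdim𝔟, hcard, hdimK, hdimI, Nat.add_sub_cancel, Nat.add_sub_add_right,
      Nat.add_sub_add_right, Nat.add_sub_cancel] at hk
    exact hk
  -- (T4) algebraic points, and the standard fact
  have h4 : Q.Φ w ∈ Std.Alg L Q.κM := Q.Φ_mem_Alg h₂ h₃ hwAlg
  have h5 := hstd L h₂ h₃ hCM _ _ _ Q.κM 𝔟' h1 h2 h3 (Q.Φ w) (Submodule.mem_map_of_mem hw𝔟) h4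
  -- (T5) lift the kernel
  obtain ⟨k, hk, hwk⟩ := Q.exists_ker_of_Φ_mem_ker h5
  exact ⟨k, hk, w - k, hwk, by abel⟩

end Transport

end GaGmE

/-- **The analytic subgroup theorem for `𝔾ₐ × 𝔾ₘ^ι × (E♮)^κ` from the Semistability Theorem for
the explicit groups `M_κ`.** [cite: BakerWustholz2007, Thm. 6.15, §6.8] -/
theorem analyticSubgroupTheorem_GaGmE_of_std (hstd : semistabilityTheorem_std) :
    analyticSubgroupTheorem_GaGmE :=
  analyticSubgroupTheorem_GaGmE_of_semistabilityTheorem (GaGmE.semistabilityTheorem_GaGmE_of_std hstd)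

/-- **The seven 1-periods `1, 2πi, log α, ω₁, ω₂, η₁, η₂` are `ℚ̄`-linearly independent granted
the Semistability Theorem for the explicit groups `M_κ`** (Huber–Wüstholz 2022, Thm. 15.3(1);
everything between Thm. 6.15 of Baker–Wüstholz for `M_κ` and the seven periods is proved in the
tree). [cite: HuberWustholz2022, Thm. 15.3(1)] [cite: BakerWustholz2007, Thm. 6.15] -/
theorem HuberWustholzOnePeriods_of_std (hstd : semistabilityTheorem_std) : HuberWustholzOnePeriods :=
  HuberWustholzOnePeriods_of_semistabilityTheorem (GaGmE.semistabilityTheorem_GaGmE_of_std hstd)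

/-- Masser's six periods likewise. [cite: Masser1975, Ch. II Thm. II] -/
theorem masser_of_std (hstd : semistabilityTheorem_std) : masser_ellipticPeriods :=
  masser_of_semistabilityTheorem (GaGmE.semistabilityTheorem_GaGmE_of_std hstd)

end Literature.NumberTheory.Transcendental

end
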